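import Summits.QuantumAdvantage.QuantumAdvantage.Theorems.CubicForrelationNearExactIsExactTwelveBetaTransversal
import Summits.QuantumAdvantage.QuantumAdvantage.Theorems.CubicForrelationNearExactIsExactTwelveBetaAffine
import Summits.QuantumAdvantage.QuantumAdvantage.Theorems.CubicForrelationNearExactIsExactTwelveLevelSixGammaDead
import Summits.QuantumAdvantage.QuantumAdvantage.Theorems.CubicForrelationNearExactIsExactTwelveLevelFiveDuality
import Summits.QuantumAdvantage.QuantumAdvantage.Theorems.CubicForrelationNearExactIsExactTwelveLevelFiveBothDeadAt2932
import Summits.QuantumAdvantage.QuantumAdvantage.Theorems.CubicForrelationNearExactIsExactTwelveClosedGt2932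
import Literature.Computability.QuantumComplexity.SimonFourier
import Literature.Computability.QuantumComplexity.SignedForrelationGadget

/-!
# Crux `CubicForrelation.NearExactIsExact` (stmt-QuantumAdvantage-14043) — n = 12: `Φ = 29/32` is NOT a value; `Φ ≥ 29/32 ⇒ Φ = 1`

Certificate seat `b2b-cforr-cert` (gen 25).  HONEST FRAMING: a finite-slice verdict (standard axioms) about cubic Boolean pairs on 12 bits:
the boundary rung `29/32 = 928/1024` of the `n = 12` isolation analysis is closed from below as well — `29/32 ≤ Φ(f,g) ⇒ Φ(f,g) = 1`,
so `θ₁₂ ≤ 29/32` is witnessed by NO pair at `29/32` and the next candidate values lie strictly below.  It says NOTHING about the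
asymptotic conjecture `NearExactIsExact`; NOT summit progress.

The last step of the (β) × (β) kill (HOME/b2b-cforr-cert-g25/PLAN-N12-928-BETA.md, "BREAKTHROUGH"), after `tw25_boundary_reduction3`
((γ) is dead, both sides are in configuration (β)), `tbc_fibres` / `tbl_no_four` / `tbt_transversal` (STEPS 1–2) and `tba_affine`
(STEP 3):
* `tbd_coset_sum`: an affine sign pattern on a coset `a ⊕ P` has character sum `Σ_{p∈P} (−1)^{β(a⊕p)} (−1)^{(a⊕p)·y} ∈ #P·ℤ`
  (`bd_hom_sum`).
* `tbd_beta_beta_false`: hence `Ŝ(y) = Σ_x e(x)(−1)^{x·y} ∈ 128ℤ` (`Z = ⊔ₐ a ⊕ P` over the six anchors), while the level-5 duality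
  `l5k_duality` gives `Ŝ(y) = −64·e′(y)` with `e′(y) = ±1` on the partner's even set — contradiction.
* `tw27_window_ge2932_false`, `tw27_ge2932_eq_one`, `isolation_twelve_ge_2932`, `no_window_twelve_ge_2932`, `not_value_2932_twelve`,
  `exact_or_lt_2932_twelve`, `tw27_gt_14847_eq_one`, `isolation_twelve_gt_14847`, `theta_twelve_lt_2932` (`θ₁₂ ≤ 29/32 − 2⁻¹⁴`): packaging.

References: MacWilliams–Sloane (1977) Ch. 13–15; R. O'Donnell (2014) §1.4; D. Simon (1994) §3.1.  Axioms: the standard three.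
-/

set_option linter.dupNamespace false -- D-0017: single-problem summit ⇒ `QuantumAdvantage.QuantumAdvantage` by design

noncomputable section

namespace Summit.QuantumAdvantage.QuantumAdvantage.Theorems.CubicForrelation.NearExactIsExact

open Finset
open Literature.Computability.QuantumComplexity
open Literature.Computability.QuantumComplexity.BuzetChailloux (bxor zeroVec bxor_bxor_cancel_left bxor_zeroVec zeroVec_bxor bxor_comm
  bxor_self)
open Literature.Computability.QuantumComplexity.DerivativeWalsh (W)

/-- `(−1)^{a ⊕ b} = (−1)^a (−1)^b` (real casts). [folklore] -/
theorem tbd_sZ_xor_cast (a b : Bool) : ((sZ (a ^^ b) : ℤ) : ℝ) = ((sZ a : ℤ) : ℝ) * ((sZ b : ℤ) : ℝ) := by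
  cases a <;> cases b <;> simp [sZ]

/-- `((−1)^b)² = 1` (real casts). [folklore] -/
theorem tbd_sZ_mul_self_cast (b : Bool) : ((sZ b : ℤ) : ℝ) * ((sZ b : ℤ) : ℝ) = 1 := by
  cases b <;> simp [sZ]

/-- xor bookkeeping. [folklore] -/
theorem tbd_idA (m s b : Fin (6 + 6) → Bool) : bxor (bxor m s) (bxor s b) = bxor m b := by
  funext k; simp only [bxor]; cases m k <;> cases s k <;> cases b k <;> rfl

/-- xor bookkeeping. [folklore] -/
theorem tbd_idB (a b p q : Fin (6 + 6) → Bool) (h : bxor b q = bxor a p) : bxor a b = bxor p q := by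
  funext k
  have hk := congrFun h k
  simp only [bxor] at hk ⊢
  revert hk
  cases a k <;> cases b k <;> cases p k <;> cases q k <;> decide

/-- A finite sum of multiples of `128` is a multiple of `128`. [folklore] -/
theorem tbd_sum_mul128 (T : Finset (Fin (6 + 6) → Bool)) (G : (Fin (6 + 6) → Bool) → ℝ)
    (h : ∀ a ∈ T, ∃ k : ℤ, G a = 128 * k) : ∃ K : ℤ, ∑ a ∈ T, G a = 128 * K := by
  classical
  induction T using Finset.induction_on with
  | empty => exact ⟨0, by simp⟩
  | insert a T haT ih =>
    obtain ⟨K, hK⟩ := ih (fun b hb => h b (mem_insert_of_mem hb))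
    obtain ⟨k, hk⟩ := h a (mem_insert_self _ _)
    exact ⟨k + K, by rw [sum_insert haT, hk, hK]; push_cast; ring⟩

/-- **Character sum of an affine sign pattern on a coset.**  `P` closed under `⊕`, `β(a ⊕ ·)` affine on `P`; then for every `y`,
`Σ_{p∈P} (−1)^{β(a⊕p)} (−1)^{(a⊕p)·y} ∈ #P · ℤ` (it is `± #P` or `0`, `bd_hom_sum`). [this work] -/
theorem tbd_coset_sum (P : Finset (Fin (6 + 6) → Bool)) (hPadd : ∀ a ∈ P, ∀ b ∈ P, bxor a b ∈ P)
    (β : (Fin (6 + 6) → Bool) → Bool) (a : Fin (6 + 6) → Bool)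
    (haff : ∀ p ∈ P, ∀ q ∈ P, β (bxor a (bxor p q)) = (β (bxor a p) ^^ β (bxor a q) ^^ β a)) (y : Fin (6 + 6) → Bool) :
    ∃ k : ℤ, ∑ p ∈ P, ((sZ (β (bxor a p)) : ℤ) : ℝ) * twist (bxor a p) y = (#P : ℝ) * k := by
  classical
  set η : (Fin (6 + 6) → Bool) → ℝ := fun p => ((sZ (β (bxor a p)) : ℤ) : ℝ) * ((sZ (β a) : ℤ) : ℝ) * twist p y with hη
  have hη1 : ∀ p ∈ P, η p = 1 ∨ η p = -1 := by
    intro p _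
    rcases tp_sZ_cases (β (bxor a p)) with h1 | h1 <;> rcases tp_sZ_cases (β a) with h2 | h2 <;>
      rcases Simon.twist_eq_one_or p y with h3 | h3 <;> simp [hη, h1, h2, h3]
  have hmul : ∀ p ∈ P, ∀ q ∈ P, η (bxor p q) = η p * η q := by
    intro p hp q hq
    simp only [hη]
    rw [haff p hp q hq, tbd_sZ_xor_cast, tbd_sZ_xor_cast, Simon.twist_xor_left p q y]
    ring
  have hsum := bd_hom_sum P hPadd η hη1 hmul
  have hfac : ∑ p ∈ P, ((sZ (β (bxor a p)) : ℤ) : ℝ) * twist (bxor a p) y = ((sZ (β a) : ℤ) : ℝ) * twist a y * ∑ p ∈ P, η p := by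
    rw [Finset.mul_sum]
    refine sum_congr rfl fun p _ => ?_
    simp only [hη]
    rw [Simon.twist_xor_left a p y]
    have hs := tbd_sZ_mul_self_cast (β a)
    linear_combination (-(((sZ (β (bxor a p)) : ℤ) : ℝ) * twist a y * twist p y)) * hs
  rcases hsum with h0 | hP
  · exact ⟨0, by rw [hfac, h0]; simp⟩
  · rcases tp_sZ_cases (β a) with h2 | h2 <;> rcases Simon.twist_eq_one_or a y with h3 | h3
    · exact ⟨1, by rw [hfac, hP, h2, h3]; push_cast; ring⟩
    · exact ⟨-1, by rw [hfac, hP, h2, h3]; push_cast; ring⟩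
    · exact ⟨-1, by rw [hfac, hP, h2, h3]; push_cast; ring⟩
    · exact ⟨1, by rw [hfac, hP, h2, h3]; push_cast; ring⟩

/-- **Configuration (β) × (β) is impossible.**  Cubic `f, g` on 12 bits with `W_g = 64u''`, `W_f = 64wf`; on the `g`-side
`Z = {u'' even}` has 768 points, `e = u'' − (−1)^f` is `±1` on `Z` and `0` off `Z`; on the `f`-side `Z′ = {wf even}` has 768 points and
`e′ = wf − (−1)^g` is `±1` on `Z′`.  Contradiction (module docstring). [this work] -/
theorem tbd_beta_beta_false (f g : (Fin (6 + 6) → Bool) → Bool) (hf : IsDegLeFun 3 f) (hg : IsDegLeFun 3 g)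
    (u'' : (Fin (6 + 6) → Bool) → ℤ) (hu'' : ∀ x, W (fun y => signOf (g y)) x = (2 : ℝ) ^ 6 * (u'' x : ℝ))
    (wf : (Fin (6 + 6) → Bool) → ℤ) (hwf : ∀ y, W (fun x => signOf (f x)) y = (2 : ℝ) ^ 6 * (wf y : ℝ))
    (h768 : #(univ.filter fun x : Fin (6 + 6) → Bool => ¬ Odd (u'' x)) = 768)
    (hZ1 : ∀ x ∈ (univ.filter fun x : Fin (6 + 6) → Bool => ¬ Odd (u'' x)), (u'' x - sZ (f x)) ^ 2 = 1)
    (hoff0 : ∀ y, y ∉ (univ.filter fun x : Fin (6 + 6) → Bool => ¬ Odd (u'' x)) → u'' y - sZ (f y) = 0)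
    (h768' : #(univ.filter fun y : Fin (6 + 6) → Bool => ¬ Odd (wf y)) = 768)
    (hZ1' : ∀ y ∈ (univ.filter fun y : Fin (6 + 6) → Bool => ¬ Odd (wf y)), (wf y - sZ (g y)) ^ 2 = 1) : False := by
  classical
  set Z := univ.filter (fun x : Fin (6 + 6) → Bool => ¬ Odd (u'' x)) with hZdef
  set P := (univ.filter fun a : Fin (6 + 6) → Bool => ∀ x, decide (Odd (u'' (bxor x a))) = decide (Odd (u'' x))) with hPdef
  -- the sign bit on `Z`
  obtain ⟨β, hβdef⟩ : ∃ β : (Fin (6 + 6) → Bool) → Bool, β = fun x => decide (u'' x - sZ (f x) = -1) := ⟨_, rfl⟩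
  have hβ : ∀ x ∈ Z, u'' x - sZ (f x) = sZ (β x) := by
    intro x hx
    have h := hZ1 x hx
    have hprod : (u'' x - sZ (f x) - 1) * (u'' x - sZ (f x) + 1) = 0 := by ring_nf; linarith [h]
    rcases mul_eq_zero.1 hprod with h1 | h1
    · have e1 : u'' x - sZ (f x) = 1 := by linarith
      have hb : β x = false := by
        rw [hβdef]; show decide (u'' x - sZ (f x) = -1) = false; rw [e1]; decide
      rw [e1, hb]; simp [sZ]
    · have e1 : u'' x - sZ (f x) = -1 := by linarith
      have hb : β x = true := by
        rw [hβdef]; show decide (u'' x - sZ (f x) = -1) = true; rw [e1]; decide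
      rw [e1, hb]; simp [sZ]
  -- fibres, transversal identity, affine patterns
  obtain ⟨m₁, m₂, m₃, m₄, m₅, m₆, ⟨hm₁, hm₂, hm₃, hm₄, hm₅, hm₆⟩, hdist, hcov⟩ := tbc_fibres g hg u'' hu'' h768
  obtain ⟨hA, hstar⟩ := tbt_transversal f g hf hg u'' hu'' h768 β hβ hoff0 m₁ m₂ m₃ m₄ m₅ m₆ hm₁ hm₂ hm₃ hm₄ hm₅ hm₆ hdist hcov
  have hP0 : zeroVec ∈ P := tbc_P_zero u''
  have hPadd : ∀ a ∈ P, ∀ b ∈ P, bxor a b ∈ P := tbc_P_add u''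
  have hZst : ∀ x ∈ Z, ∀ a ∈ P, bxor x a ∈ Z := fun x hx a ha => tbc_Z_stable u'' hx ha
  have hP : #P = 128 := tbc_card_P g hg u'' hu'' h768
  obtain ⟨S, hS⟩ : ∃ S : Fin (6 + 6) → Bool, S = bxor (bxor (bxor (bxor m₁ m₂) m₃) m₄) m₅ := ⟨_, rfl⟩
  have hA' : bxor S m₆ ∈ P := by rw [hS]; exact hA
  have haff := tba_affine P hP0 hPadd β m₁ m₂ m₃ m₄ m₅ S (by rw [hS]; exact hstar)
  -- the six anchors
  set M' := ({m₁, m₂, m₃, m₄, m₅, S} : Finset (Fin (6 + 6) → Bool)) with hM'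
  have hSZ : S ∈ Z := by
    have h := hZst _ hm₆ _ (show bxor m₆ S ∈ P by rw [bxor_comm]; exact hA')
    rwa [bxor_bxor_cancel_left] at h
  have hM'Z : ∀ a ∈ M', a ∈ Z := by
    intro a ha
    simp only [hM', mem_insert, mem_singleton] at ha
    rcases ha with rfl | rfl | rfl | rfl | rfl | rfl <;> assumption
  have hne : ∀ a b, bxor a b ∉ P → a ≠ b := by
    rintro a b h rfl; rw [bxor_self] at h; exact h hP0
  have d12 := hdist m₁ m₂ (by simp); have d13 := hdist m₁ m₃ (by simp); have d14 := hdist m₁ m₄ (by simp)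
  have d15 := hdist m₁ m₅ (by simp); have d23 := hdist m₂ m₃ (by simp); have d24 := hdist m₂ m₄ (by simp)
  have d25 := hdist m₂ m₅ (by simp); have d34 := hdist m₃ m₄ (by simp); have d35 := hdist m₃ m₅ (by simp)
  have d45 := hdist m₄ m₅ (by simp)
  have dS : ∀ m, bxor m m₆ ∉ P → bxor m S ∉ P := by
    intro m hm6 hmS
    apply hm6
    have h := hPadd _ hmS _ hA'
    rwa [tbd_idA] at h
  have dS1 := dS m₁ (hdist m₁ m₆ (by simp)); have dS2 := dS m₂ (hdist m₂ m₆ (by simp)); have dS3 := dS m₃ (hdist m₃ m₆ (by simp))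
  have dS4 := dS m₄ (hdist m₄ m₆ (by simp)); have dS5 := dS m₅ (hdist m₅ m₆ (by simp))
  have hpair' : ∀ a ∈ M', ∀ b ∈ M', a ≠ b → bxor a b ∉ P := by
    intro a ha b hb hab
    simp only [hM', mem_insert, mem_singleton] at ha hb
    rcases ha with rfl | rfl | rfl | rfl | rfl | rfl <;> rcases hb with rfl | rfl | rfl | rfl | rfl | rfl <;>
      first
        | exact absurd rfl hab
        | assumption
        | (rw [bxor_comm]; assumption)
  have hcov' : ∀ x ∈ Z, ∃ a ∈ M', bxor a x ∈ P := by
    intro x hx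
    rcases hcov x hx with h | h | h | h | h | h
    · exact ⟨m₁, by simp [hM'], h⟩
    · exact ⟨m₂, by simp [hM'], h⟩
    · exact ⟨m₃, by simp [hM'], h⟩
    · exact ⟨m₄, by simp [hM'], h⟩
    · exact ⟨m₅, by simp [hM'], h⟩
    · refine ⟨S, by simp [hM'], ?_⟩
      have h' := hPadd _ hA' _ h
      rwa [tbd_idA] at h'
  -- `Z` is the disjoint union of the six cosets
  have hZeq : Z = M'.biUnion (fun a => P.image (bxor a)) := by
    ext x
    constructor
    · intro hx
      obtain ⟨a, ha, hax⟩ := hcov' x hx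
      exact mem_biUnion.2 ⟨a, ha, mem_image.2 ⟨bxor a x, hax, bxor_bxor_cancel_left a x⟩⟩
    · intro hx
      obtain ⟨a, ha, hx'⟩ := mem_biUnion.1 hx
      obtain ⟨p, hp, rfl⟩ := mem_image.1 hx'
      exact hZst _ (hM'Z a ha) _ hp
  have hdisj : (M' : Set (Fin (6 + 6) → Bool)).PairwiseDisjoint (fun a => P.image (bxor a)) := by
    intro a ha b hb hab
    rw [Function.onFun, Finset.disjoint_left]
    intro x hxa hxb
    obtain ⟨p, hp, rfl⟩ := mem_image.1 hxa
    obtain ⟨q, hq, hq'⟩ := mem_image.1 hxb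
    apply hpair' a ha b hb hab
    rw [tbd_idB a b p q hq']
    exact hPadd _ hp _ hq
  -- a point of the partner's even set
  obtain ⟨y₀, hy₀⟩ := (Finset.card_pos.1 (by rw [h768']; norm_num) :
    (univ.filter fun y : Fin (6 + 6) → Bool => ¬ Odd (wf y)).Nonempty)
  have hsq := hZ1' y₀ hy₀
  -- `Ŝ(y₀) ∈ 128ℤ`
  have hS128 : ∃ K : ℤ, ∑ x, (((u'' x - sZ (f x) : ℤ)) : ℝ) * twist x y₀ = 128 * K := by
    have hres : ∑ x, (((u'' x - sZ (f x) : ℤ)) : ℝ) * twist x y₀ = ∑ x ∈ Z, (((u'' x - sZ (f x) : ℤ)) : ℝ) * twist x y₀ := by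
      symm
      apply sum_subset (subset_univ Z)
      intro x _ hx
      rw [hoff0 x hx]; simp
    rw [hres, hZeq, sum_biUnion hdisj]
    refine tbd_sum_mul128 M' _ fun a ha => ?_
    rw [sum_image (fun p _ q _ h => by simpa using congrArg (bxor a) h)]
    obtain ⟨k, hk⟩ := tbd_coset_sum P hPadd β a (haff a ha) y₀
    refine ⟨k, ?_⟩
    rw [show (128 : ℝ) * k = (#P : ℝ) * k by rw [hP]; norm_num, ← hk]
    refine sum_congr rfl fun p hp => ?_
    rw [hβ _ (hZst _ (hM'Z a ha) _ hp)]
  obtain ⟨K, hK⟩ := hS128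
  -- the level-5 duality: `Ŝ(y₀) = −64 e′(y₀)`
  have hdual := l5k_duality f g (fun x => 2 * u'' x) (fun x => by rw [hu'']; push_cast; ring) (fun y => 2 * wf y)
    (fun y => by rw [hwf]; push_cast; ring) y₀
  beta_reduce at hdual
  have hlhs : ∑ a, (((2 * u'' a - 2 * sZ (f a) : ℤ)) : ℝ) * twist a y₀ = 2 * (128 * K) := by
    rw [← hK, mul_sum]
    refine sum_congr rfl fun x _ => ?_
    push_cast; ring
  rw [hlhs] at hdual
  have hint : (2 : ℤ) * (128 * K) = -64 * (2 * wf y₀ - 2 * sZ (g y₀)) := by exact_mod_cast hdual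
  have he' : wf y₀ - sZ (g y₀) = -2 * K := by linarith
  rw [he'] at hsq
  have h4 : (4 : ℤ) ∣ 1 := ⟨K ^ 2, by nlinarith [hsq]⟩
  norm_num at h4

/-- **No cubic pair on 12 bits has `29/32 ≤ Φ < 1`.** [this work] -/
theorem tw27_window_ge2932_false (f g : (Fin (6 + 6) → Bool) → Bool) (hf : IsDegLeFun 3 f) (hg : IsDegLeFun 3 g)
    (hΦ : (29 / 32 : ℝ) ≤ forrelation f g) (hhi : forrelation f g < 1) : False := by
  obtain ⟨u'', hu'', -, -, h768, hZ1, hoff0⟩ := tw25_boundary_reduction3 f g hf hg hΦ hhi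
  obtain ⟨wf, hwf, -, -, h768', hZ1', -⟩ := tw25_boundary_reduction3_symm f g hf hg hΦ hhi
  exact tbd_beta_beta_false f g hf hg u'' hu'' wf hwf h768 hZ1 hoff0 h768' hZ1'

/-- **`29/32 ≤ Φ ⇒ Φ = 1`** for cubic pairs on 12 bits. [this work] -/
theorem tw27_ge2932_eq_one (f g : (Fin (6 + 6) → Bool) → Bool) (hf : IsDegLeFun 3 f) (hg : IsDegLeFun 3 g)
    (hΦ : (29 / 32 : ℝ) ≤ forrelation f g) : forrelation f g = 1 := by
  have hle : forrelation f g ≤ 1 := (abs_le.1 (SgnForrMem.abs_forrelation_le_one f g)).2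
  rcases hle.lt_or_eq with hlt | heq
  · exact (tw27_window_ge2932_false f g hf hg hΦ hlt).elim
  · exact heq

/-- **Isolation from `29/32` on (closed rung)**: for cubic pairs on 12 bits, `29/32 ≤ Φ(f,g) ⇒ Φ(f,g) = 1` — the boundary rung
`29/32 = 928/1024` left open by `isolation_twelve_gt_2932` / `theta_twelve_le_2932` is NOT a value.  Finite-slice verdict, NOT summit
progress. [this work] -/
theorem isolation_twelve_ge_2932 : ∀ f g : (Fin 12 → Bool) → Bool, IsDegLeFun 3 f → IsDegLeFun 3 g →
    (29 / 32 : ℝ) ≤ forrelation f g → forrelation f g = 1 :=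
  fun f g hf hg h => tw27_ge2932_eq_one f g hf hg h

/-- **No cubic pair on 12 bits has `29/32 ≤ Φ < 1`** (packaging). [this work] -/
theorem no_window_twelve_ge_2932 : ¬ ∃ f g : (Fin 12 → Bool) → Bool, IsDegLeFun 3 f ∧ IsDegLeFun 3 g ∧
    (29 / 32 : ℝ) ≤ forrelation f g ∧ forrelation f g < 1 := by
  rintro ⟨f, g, hf, hg, hlo, hhi⟩
  have h := tw27_ge2932_eq_one f g hf hg hlo
  rw [h] at hhi
  exact lt_irrefl _ hhi

/-- **`29/32` is not a forrelation value of a cubic pair on 12 bits.** [this work] -/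
theorem not_value_2932_twelve : ¬ ∃ f g : (Fin 12 → Bool) → Bool, IsDegLeFun 3 f ∧ IsDegLeFun 3 g ∧
    forrelation f g = 29 / 32 := by
  rintro ⟨f, g, hf, hg, h⟩
  have h1 := tw27_ge2932_eq_one f g hf hg h.symm.le
  rw [h1] at h
  norm_num at h

/-- **Either exact, or `Φ < 29/32`** for cubic pairs on 12 bits (packaging; sharpens `exact_or_le_2932_twelve`). [this work] -/
theorem exact_or_lt_2932_twelve (f g : (Fin 12 → Bool) → Bool) (hf : IsDegLeFun 3 f) (hg : IsDegLeFun 3 g) :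
    forrelation f g = 1 ∨ forrelation f g < 29 / 32 := by
  by_cases h : (29 / 32 : ℝ) ≤ forrelation f g
  · exact Or.inl (tw27_ge2932_eq_one f g hf hg h)
  · exact Or.inr (not_le.1 h)

/-- **`Φ > 14847/16384 ⇒ Φ = 1`** on 12 bits: value granularity `2⁻¹⁴` (`stub_valueGranularity`) and `14848/16384 = 29/32`. [this work] -/
theorem tw27_gt_14847_eq_one (f g : (Fin 12 → Bool) → Bool) (hf : IsDegLeFun 3 f) (hg : IsDegLeFun 3 g)
    (hΦ : (14847 / 16384 : ℝ) < forrelation f g) : forrelation f g = 1 := by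
  obtain ⟨z, hz⟩ := stub_valueGranularity stub_axParity 6 f g hg
  norm_num at hz
  have hΦz : forrelation f g = (z : ℝ) / 16384 := by linarith
  have hzr : (14847 : ℝ) < (z : ℝ) := by rw [hΦz] at hΦ; linarith
  have hzi : (14847 : ℤ) < z := by exact_mod_cast hzr
  have hzi' : (14848 : ℤ) ≤ z := by omega
  have hzr' : (14848 : ℝ) ≤ (z : ℝ) := by exact_mod_cast hzi'
  exact tw27_ge2932_eq_one f g hf hg (by rw [hΦz]; linarith)

/-- **Isolation above `14847/16384 = 29/32 − 2⁻¹⁴`** on 12 bits (packaging). [this work] -/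
theorem isolation_twelve_gt_14847 : ∀ f g : (Fin 12 → Bool) → Bool, IsDegLeFun 3 f → IsDegLeFun 3 g →
    (14847 / 16384 : ℝ) < forrelation f g → forrelation f g = 1 :=
  fun f g hf hg h => tw27_gt_14847_eq_one f g hf hg h

/-- **`θ₁₂ ≤ 29/32 − 2⁻¹⁴`**, i.e. `θ₁₂ ∈ [57/64, 14847/16384]`: the least isolation threshold for cubic pairs on 12 bits is at least the
record `57/64` (`theta_twelve_bounds`) and at most `14847/16384` (`isolation_twelve_gt_14847`); the boundary value `29/32` is NOT attained
(sharpens `theta_twelve_le_2932`).  Finite-slice verdict, NOT summit progress. [this work] -/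
theorem theta_twelve_lt_2932 : ∃ θ₀ : ℝ, 57 / 64 ≤ θ₀ ∧ θ₀ ≤ 14847 / 16384 ∧
    IsLeast {θ : ℝ | ∀ f g : (Fin 12 → Bool) → Bool, IsDegLeFun 3 f → IsDegLeFun 3 g →
      θ < forrelation f g → forrelation f g = 1} θ₀ := by
  obtain ⟨θ₀, hθ₀⟩ := theta_exists 12
  exact ⟨θ₀, theta_twelve_bounds.2 θ₀ hθ₀.1, hθ₀.2 isolation_twelve_gt_14847, hθ₀⟩

end Summit.QuantumAdvantage.QuantumAdvantage.Theorems.CubicForrelation.NearExactIsExact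

end
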